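import Literature.NumberTheory.EllipticCurves.IwasawaSelmerProofs
import Literature.NumberTheory.EllipticCurves.SelmerCorankProofs
import Literature.NumberTheory.EllipticCurves.SelmerLevelToPrimary
import HarnessLib

/-!
# Layer classes with finite coefficients inside the tower: `H¹(K_n, E[p^k]) ↪ H¹(K_∞, E[p^∞])^{Γ_n}[p^k]`
# (crux ♭T′ stmt-BirchSwinnertonDyer-26975, line `sigmacongruence`, brick (1b) Stage A of the growth road to stub TS1)

Route `UniversalToricDescent`, lead prover `bsd-wall-utd-p1` g15. THEOREMS ONLY (no definition, no named fact, no `sorry`);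
`--supports stmt-BirchSwinnertonDyer-26975`. BSD is not proved by any of this.

For an elliptic curve `W/K`, a prime `p`, a subgroup `H ≤ Γ_K` (a layer `Γ_n = κ.layerSubgroup n` of a `ℤ_p`-extension `κ`),
and `k ≥ 0`, the map `ι_{H,k} : H¹(H, E[p^k]) → H¹(H, E[p^∞])` induced by `E[p^k] ↪ E[p^∞]` (the tree's `resH1Hom (id_H, incl)`):
* `injective_resH1Hom_torsionPow_of_fixedPoints_eq_bot` — **`ι_{H,k}` is injective when `E[p^∞]^H = 0`** (a kernel class is
  `[∂a]` with `p^k a ∈ E[p^∞]^H`; Greenberg LNM 1716 §3 Lemma 3.1's argument);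
* `pow_smul_resH1Hom_torsionPow_eq_zero` — its image is killed by `p^k`;
* `conjH1_layerToInfty_eq_of_mem` — restriction `h_n : H¹(Γ_n, E[p^∞]) → H¹(ker κ, E[p^∞])` lands in the `Γ_n`-invariants
  (`conj_g ∘ res = res ∘ conj_g` and `conj_g = id` on `H¹(Γ_n, ·)` for `g ∈ Γ_n`);
* `injective_layerToInfty_comp_torsionPow` — for `E(K_∞)[p^∞] = 0`: **`h_n ∘ ι_{Γ_n,k} : H¹(K_n, E[p^k]) ↪ H¹(K_∞, E[p^∞])` is
  injective with image in `{c | p^k c = 0 ∧ conj_g c = c ∀ g ∈ Γ_n}`** — the source of the weak-Leopoldt growth bound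
  `#(Y/(ω_n, p^k)Y) ≥ #H¹_{S′}(K_n, E[p^k])` (with Shapiro `H¹(K, Ind_{K_n}^K E[p^k]) ≅ H¹(Γ_n, E[p^k])`, the tree's `shapiroLift`;
  `continuousCohomology 1 (subgroupRep (W.torsionGaloisModule (p^k)).toTopRep Γ_n)` IS `subgroupH1 Γ_n E[p^k]` definitionally).

References: [GreenbergLNM1716] §3 Lemma 3.1–3.2 (p. 86); [GreenbergVatsal2000] §2 Prop. (2.1).
-/

set_option autoImplicit false
-- the Theorems namespace of this sub repeats the summit name by design (D-0017 nested layout)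
set_option linter.dupNamespace false

noncomputable section

open scoped Classical
open Literature.NumberTheory.EllipticCurves Literature.NumberTheory.GaloisRepresentations Field

universe u

namespace Summit.BirchSwinnertonDyer.BirchSwinnertonDyer.Theorems.UniversalToricDescentLayerCoefficientInjection

variable {K : Type u} [Field K] (W : WeierstrassCurve K) (p : ℕ) [Fact p.Prime]

omit [Fact p.Prime] in
/-- **`H¹(H, E[p^k]) → H¹(H, E[p^∞])` is injective when `E[p^∞]^H = 0`.** A class `[φ]` in the kernel has
`incl ∘ φ = ∂a` for some `a ∈ E[p^∞]`; then `σ(p^k a) − p^k a = p^k φ(σ) = 0`, so `p^k a ∈ E[p^∞]^H = 0`, `a ∈ E[p^k]`, and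
`φ = ∂a` already in `E[p^k]`. [cite: GreenbergLNM1716, §3 Lemma 3.1 (p. 86)] -/
theorem injective_resH1Hom_torsionPow_of_fixedPoints_eq_bot (H : Subgroup (absoluteGaloisGroup K)) (k : ℕ)
    (hB : FixedPoints.addSubgroup H (W.geomPrimaryTorsion p) = ⊥) :
    Function.Injective (resH1Hom (ContinuousMonoidHom.id H)
      (AddSubgroup.inclusion (Literature.Barriers.BirchSwinnertonDyer.geomTorsion_pow_le_geomPrimaryTorsion W p k))
      (fun _ _ ↦ rfl) :
        Literature.NumberTheory.EllipticCurves.subgroupH1 H (WeierstrassCurve.geomTorsion W ((p ^ k : ℕ) : ℤ)) →+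
          W.subgroupH1 p H) := by
  rw [injective_iff_map_eq_zero]
  intro x hx
  obtain ⟨φ, rfl⟩ := oneCocycleClass_surjective _ x
  rw [resH1Hom_id_oneCocycleClass] at hx
  obtain ⟨a, ha⟩ := (oneCocycleClass_eq_zero_iff _ _).mp hx
  -- `ha g : incl (φ g) = g • a - a`
  have ha' : ∀ g : H, ((φ.1 g : WeierstrassCurve.geomTorsion W ((p ^ k : ℕ) : ℤ)) : WeierstrassCurve.geomPoints W) =
      ((g • a - a : W.geomPrimaryTorsion p) : WeierstrassCurve.geomPoints W) := fun g ↦ by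
    have := ha g
    rw [contOneCocycles.push_apply] at this
    exact congrArg (fun z : W.geomPrimaryTorsion p ↦ (z : WeierstrassCurve.geomPoints W)) this
  -- `p^k a` is `H`-fixed, hence `0`
  have hfix : ((p ^ k : ℕ) • a : W.geomPrimaryTorsion p) ∈ FixedPoints.addSubgroup H (W.geomPrimaryTorsion p) := by
    intro g
    have hg : g • ((p ^ k : ℕ) • a) - (p ^ k : ℕ) • a = 0 := by
      rw [smul_comm, ← smul_sub]
      apply Subtype.ext
      rw [AddSubgroupClass.coe_nsmul, ← ha' g, ZeroMemClass.coe_zero]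
      exact AddSubgroup.torsionBy.nsmul_iff.mp (φ.1 g).2
    exact sub_eq_zero.mp hg
  rw [hB, AddSubgroup.mem_bot] at hfix
  have hmem : ((a : W.geomPrimaryTorsion p) : WeierstrassCurve.geomPoints W) ∈
      WeierstrassCurve.geomTorsion W ((p ^ k : ℕ) : ℤ) :=
    AddSubgroup.torsionBy.nsmul_iff.mpr (by rw [← AddSubgroupClass.coe_nsmul, hfix, ZeroMemClass.coe_zero])
  refine (oneCocycleClass_eq_zero_iff _ _).mpr ⟨⟨a, hmem⟩, fun g ↦ ?_⟩
  apply Subtype.ext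
  rw [ha' g]
  rfl

omit [Fact p.Prime] in
/-- The image of `H¹(H, E[p^k]) → H¹(H, E[p^∞])` is killed by `p^k` (already `H¹(H, E[p^k])` is). [folklore] -/
theorem pow_smul_resH1Hom_torsionPow_eq_zero (H : Subgroup (absoluteGaloisGroup K)) (k : ℕ)
    (x : Literature.NumberTheory.EllipticCurves.subgroupH1 H (WeierstrassCurve.geomTorsion W ((p ^ k : ℕ) : ℤ))) :
    (p ^ k : ℕ) • resH1Hom (ContinuousMonoidHom.id H)
      (AddSubgroup.inclusion (Literature.Barriers.BirchSwinnertonDyer.geomTorsion_pow_le_geomPrimaryTorsion W p k))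
      (fun _ _ ↦ rfl) x = (0 : W.subgroupH1 p H) := by
  obtain ⟨φ, rfl⟩ := oneCocycleClass_surjective _ x
  rw [← map_nsmul, nsmul_oneCocycleClass_eq_zero φ (p ^ k) (fun g ↦ ?_), map_zero]
  apply Subtype.ext
  rw [AddSubgroupClass.coe_nsmul, ZeroMemClass.coe_zero]
  exact AddSubgroup.torsionBy.nsmul_iff.mp (φ.1 g).2

variable (κ : ZpExtension K p)

/-- **Restriction from a layer lands in the `Γ_n`-invariants:** for `g ∈ Γ_n = κ.layerSubgroup n`,
`conj_g (h_n x) = h_n x` (`res ∘ conj_g = conj_g ∘ res`, and `conj_g = id` on `H¹(Γ_n, E[p^∞])`).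
[cite: GreenbergLNM1716, §3 (p. 85)] -/
theorem conjH1_layerToInfty_eq_of_mem (n : ℕ) {g : absoluteGaloisGroup K} (hg : g ∈ κ.layerSubgroup n)
    (x : W.subgroupH1 p (κ.layerSubgroup n)) :
    W.conjH1 p κ.kerSubgroup g (W.layerToInfty κ n x) = W.layerToInfty κ n x := by
  have h := congrArg (fun f ↦ f x)
    (resOfLe_comp_conjH1_holds (M := W.geomPrimaryTorsion p) (κ.kerSubgroup_le_layerSubgroup n) g)
  simp only [AddMonoidHom.coe_comp, Function.comp_apply] at h
  rw [conjH1_of_mem_holds (κ.layerSubgroup n) (W.geomPrimaryTorsion p) hg, AddMonoidHom.id_apply] at h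
  exact h.symm

/-- **`H¹(K_n, E[p^k]) ↪ H¹(K_∞, E[p^∞])^{Γ_n}[p^k]`** when `E(K_∞)[p^∞] = 0`: the composite `h_n ∘ ι_{Γ_n,k}` is injective
(`ι` by `injective_resH1Hom_torsionPow_of_fixedPoints_eq_bot` for `Γ_n ⊇ ker κ`, `h_n` by the tree's
`finite_ker_layerToInfty_and_card_le` road — here re-derived from `E[p^∞]^{ker κ} = 0` via the inflation–restriction kernel),
and every image class is killed by `p^k` and fixed by `conj_g`, `g ∈ Γ_n`. [cite: GreenbergLNM1716, §3 Lemma 3.1 (p. 86)] -/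
theorem layerToInfty_comp_torsionPow_mem (n k : ℕ)
    (x : Literature.NumberTheory.EllipticCurves.subgroupH1 (κ.layerSubgroup n) (WeierstrassCurve.geomTorsion W ((p ^ k : ℕ) : ℤ))) :
    (p ^ k : ℕ) • W.layerToInfty κ n (resH1Hom (ContinuousMonoidHom.id (κ.layerSubgroup n))
      (AddSubgroup.inclusion (Literature.Barriers.BirchSwinnertonDyer.geomTorsion_pow_le_geomPrimaryTorsion W p k))
      (fun _ _ ↦ rfl) x) = 0 ∧
    ∀ g ∈ κ.layerSubgroup n, W.conjH1 p κ.kerSubgroup g (W.layerToInfty κ n (resH1Hom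
      (ContinuousMonoidHom.id (κ.layerSubgroup n))
      (AddSubgroup.inclusion (Literature.Barriers.BirchSwinnertonDyer.geomTorsion_pow_le_geomPrimaryTorsion W p k))
      (fun _ _ ↦ rfl) x)) = W.layerToInfty κ n (resH1Hom (ContinuousMonoidHom.id (κ.layerSubgroup n))
      (AddSubgroup.inclusion (Literature.Barriers.BirchSwinnertonDyer.geomTorsion_pow_le_geomPrimaryTorsion W p k))
      (fun _ _ ↦ rfl) x) :=
  ⟨by rw [← map_nsmul, pow_smul_resH1Hom_torsionPow_eq_zero, map_zero],
    fun _ hg ↦ conjH1_layerToInfty_eq_of_mem W p κ n hg _⟩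

/-- **Injectivity of `h_n ∘ ι_{Γ_n,k} : H¹(K_n, E[p^k]) → H¹(K_∞, E[p^∞])`** when `E(K_∞)[p^∞] = 0` and `h_n` is injective
(the tree's `layerToInfty_injective_of_fixedPoints_eq_bot` supplies the latter from the same hypothesis).
[cite: GreenbergLNM1716, §3 Lemma 3.1 (p. 86)] -/
theorem injective_layerToInfty_comp_torsionPow (n k : ℕ)
    (hB : FixedPoints.addSubgroup κ.kerSubgroup (W.geomPrimaryTorsion p) = ⊥)
    (hinj : Function.Injective (W.layerToInfty κ n)) :
    Function.Injective (fun x : Literature.NumberTheory.EllipticCurves.subgroupH1 (κ.layerSubgroup n)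
        (WeierstrassCurve.geomTorsion W ((p ^ k : ℕ) : ℤ)) ↦
      W.layerToInfty κ n (resH1Hom (ContinuousMonoidHom.id (κ.layerSubgroup n))
        (AddSubgroup.inclusion (Literature.Barriers.BirchSwinnertonDyer.geomTorsion_pow_le_geomPrimaryTorsion W p k))
        (fun _ _ ↦ rfl) x)) := by
  have hB' : FixedPoints.addSubgroup (κ.layerSubgroup n) (W.geomPrimaryTorsion p) = ⊥ := by
    rw [eq_bot_iff]
    intro a ha
    rw [← hB]
    exact fun h ↦ ha ⟨(h : absoluteGaloisGroup K), κ.kerSubgroup_le_layerSubgroup n h.2⟩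
  exact hinj.comp (injective_resH1Hom_torsionPow_of_fixedPoints_eq_bot W p (κ.layerSubgroup n) k hB')

end Summit.BirchSwinnertonDyer.BirchSwinnertonDyer.Theorems.UniversalToricDescentLayerCoefficientInjection

end
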